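import Mathlib
import Summits.ValiantsHypothesis.ValiantsHypothesis.Theorems.ValuativeGCTValuativeFlipTwoRowPencil
import Summits.ValiantsHypothesis.ValiantsHypothesis.Theorems.ValuativeGCTValuativeFlipSeedTransfer

/-!
# Explicit two-row highest-weight vectors, III: algebraic independence of the value polynomials
# (crux `ValuativeGCT.ValuativeFlip`, stmt-ValiantsHypothesis-12624; wall-breaker axis k13, part D′)

The value polynomials `G_j(Z) = P_j(t^{m-n} ∏_i (Z_i t + s))` of the two-row highest-weight vectors along
the diagonal pencil (part D) are `G_j = Π_j(e_n(Z), e_{n-1}(Z), …)` for the ABSTRACT protomorph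
polynomials `Π_j = ∑_{i ≤ j} Y_i (m Y_0)^i (-Y_1)^{j-i} C(m-i, j-i)` in free letters `Y_0, …, Y_{n-1}`
(`pencilValue_eq_esymmSubst_protoPoly`).  The substitution `Y_k ↦ e_{n-k}` is injective (fundamental
theorem of symmetric polynomials, Mathlib `esymmAlgHom_injective`; `esymmSubst_injective`), and the
Jacobian of `(Π_0, Π_2, …, Π_{n-1})` in `(Y_0, Y_2, …, Y_{n-1})` is triangular with diagonal
`1, (m Y_0)², …, (m Y_0)^{n-1}` (`pderiv_protoPoly`), so by the Jacobian criterion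
(`algebraicIndependent_of_det_pderiv_ne_zero`, `…SeedTransfer`) the value polynomials
`G_0, G_2, …, G_{n-1}` are ALGEBRAICALLY INDEPENDENT for `3 ≤ n ≤ m`
(`algebraicIndependent_pencilValue_seed`; `P_1 = 0` is skipped by `seedIdx`).

Sources: folklore.
-/

set_option linter.dupNamespace false

namespace Summit.ValiantsHypothesis.ValiantsHypothesis.Theorems.ValuativeFlip

open MvPolynomial
open scoped BigOperators

noncomputable section

section TwoRowValues

open Literature.NumberTheory.DiophantineGeometry Literature.Computability.AlgebraicComplexity
  Literature.Barriers.ValiantsHypothesis Literature.Computability.Complexity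

variable {m n : ℕ}

/-! ### Algebraic independence of the value polynomials `G_0, G_2, …, G_{n-1}` -/

/-- The `i`-th term of the abstract protomorph polynomial without its leading letter:
`(m Y_0)^i (-Y_1)^{j-i} C(m-i, j-i)`. [folklore] -/
def protoTerm (n m : ℕ) [NeZero n] (i : Fin n) (j : ℕ) : MvPolynomial (Fin n) ℂ :=
  (C (m : ℂ) * X 0) ^ (i : ℕ) * (-X 1) ^ (j - i) * C (((m - i).choose (j - i) : ℕ) : ℂ)

/-- The abstract protomorph polynomial `Π_j = ∑_{i ≤ j} Y_i (m Y_0)^i (-Y_1)^{j-i} C(m-i, j-i)` in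
free coefficient letters `Y_0, …, Y_{n-1}` (used for `j < n`). [folklore] -/
def protoPoly (n m : ℕ) [NeZero n] (j : ℕ) : MvPolynomial (Fin n) ℂ :=
  ∑ i : Fin n, if (i : ℕ) ≤ j then X i * protoTerm n m i j else 0

/-- The substitution `Y_k ↦ e_{n-k}(Z)` by elementary symmetric polynomials of the block letters.
[folklore] -/
def esymmSubst (n m : ℕ) : MvPolynomial (Fin n) ℂ →ₐ[ℂ] MvPolynomial (BlockIdx n m) ℂ :=
  aeval fun k : Fin n => esymm (BlockIdx n m) ℂ (n - k)

/-- The coefficients of the generic pencil form are `e_{n-i}(Z)` (`i ≤ n ≤ m`). [folklore] -/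
theorem bcoeff_genericPencilForm (hnm : n ≤ m) {i : ℕ} (hi : i ≤ n) :
    bcoeff m i (genericPencilForm n m) = esymm (BlockIdx n m) ℂ (n - i) := by
  classical
  have hcard : Fintype.card (BlockIdx n m) = n := card_blockIdx hnm
  have h := bcoeff_pencilForm (m := m) (fun i : BlockIdx n m => (X i : MvPolynomial (BlockIdx n m) ℂ))
    (hcard.le.trans hnm) i
  rw [hcard, if_pos hi] at h
  rw [genericPencilForm, h, esymm]

/-- **`G_j = Π_j(e_n, e_{n-1}, …)`**: the value polynomial is the abstract protomorph polynomial
evaluated at the elementary symmetric polynomials (`j < n ≤ m`). [folklore] -/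
theorem pencilValue_eq_esymmSubst_protoPoly [NeZero n] (hn : 2 ≤ n) (hnm : n ≤ m) {j : ℕ} (hj : j < n) :
    pencilValue n m j = esymmSubst n m (protoPoly n m j) := by
  classical
  have hn0 : ((0 : Fin n) : ℕ) = 0 := rfl
  have hn1 : ((1 : Fin n) : ℕ) = 1 := by
    rw [Fin.val_one', Nat.mod_eq_of_lt (by omega)]
  rw [pencilValue, bcoeff_proto (isHomogeneous_genericPencilForm hnm) (by omega), protoPoly, map_sum]
  -- the right-hand side as a sum over `range n`
  have hR : ∑ i : Fin n, esymmSubst n m (if (i : ℕ) ≤ j then X i * protoTerm n m i j else 0) =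
      ∑ i ∈ Finset.range n, if i ≤ j then esymm (BlockIdx n m) ℂ (n - i) *
        (((m : MvPolynomial (BlockIdx n m) ℂ) * esymm (BlockIdx n m) ℂ (n - 0)) ^ i *
        (-esymm (BlockIdx n m) ℂ (n - 1)) ^ (j - i) * (((m - i).choose (j - i) : ℕ) : MvPolynomial _ ℂ))
        else 0 := by
    rw [← Fin.sum_univ_eq_sum_range]
    refine Finset.sum_congr rfl fun i _ => ?_
    split_ifs with h
    · simp only [protoTerm, esymmSubst, map_mul, map_pow, map_neg, aeval_X, hn0, hn1, map_natCast]
    · rw [map_zero]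
  rw [hR, ← Finset.sum_filter]
  have hfilter : (Finset.range n).filter (fun i => i ≤ j) = Finset.range (j + 1) := by
    ext i; simp only [Finset.mem_filter, Finset.mem_range]; omega
  rw [hfilter]
  refine Finset.sum_congr rfl fun i hi => ?_
  have hij : i ≤ j := Nat.lt_succ_iff.mp (Finset.mem_range.mp hi)
  rw [bcoeff_genericPencilForm hnm (by omega), bcoeff_genericPencilForm hnm (by omega),
    bcoeff_genericPencilForm hnm (by omega)]
  ring

/-- `esymmSubst` is injective (fundamental theorem of symmetric polynomials — Mathlib's
`esymmAlgHom_injective` — after the reindexing `k ↦ n - 1 - k`). [folklore] -/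
theorem esymmSubst_injective [NeZero n] (hnm : n ≤ m) : Function.Injective (esymmSubst n m) := by
  classical
  have hcard : Fintype.card (BlockIdx n m) = n := card_blockIdx hnm
  have hfac : esymmSubst n m = ((symmetricSubalgebra (BlockIdx n m) ℂ).val.comp
      (esymmAlgHom (BlockIdx n m) ℂ n)).comp (rename (Fin.revPerm : Equiv.Perm (Fin n))) := by
    refine MvPolynomial.algHom_ext fun k => ?_
    rw [esymmSubst, aeval_X, AlgHom.comp_apply, AlgHom.comp_apply, rename_X, Subalgebra.coe_val,
      esymmAlgHom_apply, aeval_X]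
    congr 1
    rw [Fin.revPerm_apply, Fin.val_rev]
    have := k.2
    omega
  rw [hfac, AlgHom.coe_comp, AlgHom.coe_comp]
  exact (Subtype.val_injective.comp (esymmAlgHom_injective ℂ hcard.ge)).comp
    (rename_injective _ (Equiv.injective _))

/-- Letters other than `Y_0, Y_1` do not occur in `protoTerm`. [folklore] -/
theorem pderiv_protoTerm [NeZero n] {y : Fin n} (hy0 : y ≠ 0) (hy1 : y ≠ 1) (i : Fin n) (j : ℕ) :
    pderiv y (protoTerm n m i j) = 0 := by
  classical
  have h0 : (Pi.single y (1 : MvPolynomial (Fin n) ℂ) : Fin n → MvPolynomial (Fin n) ℂ) 0 = 0 :=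
    Pi.single_eq_of_ne hy0.symm _
  have h1 : (Pi.single y (1 : MvPolynomial (Fin n) ℂ) : Fin n → MvPolynomial (Fin n) ℂ) 1 = 0 :=
    Pi.single_eq_of_ne hy1.symm _
  simp only [protoTerm, pderiv_mul, pderiv_pow, pderiv_C, pderiv_X, map_neg, h0, h1,
    mul_zero, zero_mul, neg_zero, add_zero]

/-- **The Jacobian of the abstract protomorphs is triangular**: for a letter `y ∉ {Y_0, Y_1}`,
`∂Π_j/∂y = [y ≤ j] · protoTerm y j`; in particular it vanishes for `j < y` and equals `(m Y_0)^j`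
for `y = Y_j`. [folklore] -/
theorem pderiv_protoPoly [NeZero n] {y : Fin n} (hy0 : y ≠ 0) (hy1 : y ≠ 1) (j : ℕ) :
    pderiv y (protoPoly n m j) = if (y : ℕ) ≤ j then protoTerm n m y j else 0 := by
  classical
  rw [protoPoly, map_sum]
  have hterm : ∀ i : Fin n, pderiv y (if (i : ℕ) ≤ j then X i * protoTerm n m i j else 0) =
      if i = y then (if (i : ℕ) ≤ j then protoTerm n m i j else 0) else 0 := by
    intro i
    by_cases hi : (i : ℕ) ≤ j
    · rw [if_pos hi, pderiv_mul, pderiv_protoTerm hy0 hy1, mul_zero, add_zero, pderiv_X]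
      by_cases hiy : i = y
      · subst hiy
        rw [Pi.single_eq_same, one_mul, if_pos rfl, if_pos hi]
      · rw [Pi.single_eq_of_ne hiy, zero_mul, if_neg hiy]
    · rw [if_neg hi, map_zero]
      split_ifs <;> rfl
  simp only [hterm, Finset.sum_ite_eq', Finset.mem_univ, if_true]

/-- `Π_0 = Y_0`. [folklore] -/
theorem protoPoly_zero [NeZero n] : protoPoly n m 0 = X 0 := by
  classical
  rw [protoPoly, Finset.sum_eq_single (0 : Fin n)]
  · simp [protoTerm]
  · intro i _ hi
    rw [if_neg]
    intro h
    exact hi (Fin.ext (Nat.le_zero.mp h))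
  · intro h
    exact absurd (Finset.mem_univ _) h

/-- The diagonal protomorph term is `(m Y_0)^j`. [folklore] -/
theorem protoTerm_self [NeZero n] (y : Fin n) : protoTerm n m y y = (C (m : ℂ) * X 0) ^ (y : ℕ) := by
  simp [protoTerm]

/-! ### The seed index set `{0} ∪ {2, …, n-1}` and the Jacobian certificate -/

/-- The index map of the seed family: `0 ↦ 0`, `i ↦ i + 1` for `i ≥ 1` (the vanishing protomorph
`P_1 = 0` is skipped). [folklore] -/
def seedIdx (i : ℕ) : ℕ := if i = 0 then 0 else i + 1

/-- `seedIdx` is strictly monotone. [folklore] -/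
theorem seedIdx_strictMono : StrictMono seedIdx := by
  intro a b hab
  simp only [seedIdx]
  split_ifs <;> omega

/-- `seedIdx i ≤ i + 1`. [folklore] -/
theorem seedIdx_le (i : ℕ) : seedIdx i ≤ i + 1 := by
  simp only [seedIdx]; split_ifs <;> omega

/-- `seedIdx i = i + 1` for `i ≠ 0`. [folklore] -/
theorem seedIdx_of_ne_zero {i : ℕ} (hi : i ≠ 0) : seedIdx i = i + 1 := if_neg hi

/-- `seedIdx 0 = 0`. [folklore] -/
theorem seedIdx_zero : seedIdx 0 = 0 := if_pos rfl

/-- The seed letter `Y_{seedIdx i}` (`i < n - 1`). [folklore] -/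
def seedVar (i : Fin (n - 1)) : Fin n :=
  ⟨seedIdx i, by have := seedIdx_le i; have := i.2; omega⟩

/-- **The abstract protomorphs `Π_0, Π_2, …, Π_{n-1}` are algebraically independent** (`m ≠ 0`):
their Jacobian in the letters `Y_0, Y_2, …, Y_{n-1}` is triangular with diagonal
`1, (m Y_0)², …, (m Y_0)^{n-1}` (`algebraicIndependent_of_det_pderiv_ne_zero`). [folklore] -/
theorem algebraicIndependent_protoPoly_seed [NeZero n] (hn : 3 ≤ n) (hm0 : m ≠ 0) :
    AlgebraicIndependent ℂ fun i : Fin (n - 1) => protoPoly n m (seedIdx i) := by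
  classical
  apply algebraicIndependent_of_det_pderiv_ne_zero _ (fun i : Fin (n - 1) => seedVar (n := n) i)
  -- seed letters other than the first avoid `Y_0, Y_1`
  have hy : ∀ i : Fin (n - 1), (i : ℕ) ≠ 0 → seedVar (n := n) i ≠ 0 ∧ seedVar (n := n) i ≠ 1 := by
    intro i hi
    constructor
    · intro h
      have := congrArg Fin.val h
      simp only [seedVar, seedIdx_of_ne_zero hi] at this
      exact absurd this (Nat.succ_ne_zero _)
    · intro h
      have := congrArg Fin.val h
      simp only [seedVar, seedIdx_of_ne_zero hi, Fin.val_one', Nat.mod_eq_of_lt (show 1 < n by omega)] at this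
      omega
  -- the Jacobian is lower triangular
  have htri : (Matrix.of fun i i' : Fin (n - 1) =>
      pderiv (seedVar (n := n) i) (protoPoly n m (seedIdx i'))).BlockTriangular id := by
    intro i i' hlt
    have hlt' : (i' : ℕ) < i := hlt
    have hi0 : (i : ℕ) ≠ 0 := by omega
    rw [Matrix.of_apply, pderiv_protoPoly (hy i hi0).1 (hy i hi0).2, if_neg]
    simp only [seedVar]
    exact not_le.mpr (seedIdx_strictMono hlt')
  rw [Matrix.det_of_upperTriangular htri]
  refine Finset.prod_ne_zero_iff.mpr fun i _ => ?_
  rw [Matrix.of_apply]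
  by_cases hi0 : (i : ℕ) = 0
  · have hv : seedVar (n := n) i = 0 := Fin.ext (by simp [seedVar, hi0, seedIdx_zero])
    rw [hv, show seedIdx i = 0 by rw [hi0, seedIdx_zero], protoPoly_zero, pderiv_X, Pi.single_eq_same]
    exact one_ne_zero
  · rw [pderiv_protoPoly (hy i hi0).1 (hy i hi0).2]
    have hle : ((seedVar (n := n) i : Fin n) : ℕ) ≤ seedIdx i := le_refl _
    rw [if_pos hle]
    change protoTerm n m (seedVar i) ((seedVar (n := n) i : Fin n) : ℕ) ≠ 0
    rw [protoTerm_self]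
    exact pow_ne_zero _ (mul_ne_zero (by rw [Ne, C_eq_zero, Nat.cast_eq_zero]; exact hm0) (X_ne_zero _))

/-- **The value polynomials `G_0, G_2, …, G_{n-1}` of the pencil are algebraically independent**
(`3 ≤ n ≤ m`). [folklore] -/
theorem algebraicIndependent_pencilValue_seed {n m : ℕ} [NeZero n] (hn : 3 ≤ n) (hnm : n ≤ m) :
    AlgebraicIndependent ℂ fun i : Fin (n - 1) => pencilValue n m (seedIdx i) := by
  have h := (algebraicIndependent_protoPoly_seed (m := m) hn (by omega)).map' (esymmSubst_injective hnm)
  convert h using 1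
  funext i
  have hi : seedIdx i < n := by have := seedIdx_le i; have := i.2; omega
  exact pencilValue_eq_esymmSubst_protoPoly (by omega) hnm hi

end TwoRowValues

end

end Summit.ValiantsHypothesis.ValiantsHypothesis.Theorems.ValuativeFlip
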